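import Summits.CriticalPhenomena.Ising3D.TaylorTableEvenHeadParts
import Summits.CriticalPhenomena.Ising3D.TaylorTableEvenRowsTable
import Mathlib.Tactic.Linarith
import Mathlib.Tactic.Positivity
import Mathlib.Tactic.Ring
import HarnessLib

/-!
# The TABLE layer of a derivative certificate, XVIII: FAST even head cells split into parts, on the existential row contract `ValidE`
(cell `pub-ising3x`, seat boot-1 gen 8; gate (g2) — the one-screen twin announced in `TaylorTableEvenRowsTable`)

HONEST FRAMING: lottery ticket; floor = tightest certified 3D Ising CFT bounds; no exact-solution
claim without a proof. Island framing: certified exclusion region at stated derivative order and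
assumptions; not a determination of the 3D Ising critical exponents beyond that.

`evenHead_nonneg_of_parts_E`: the parts theorem `evenHead_nonneg_of_parts` (TaylorTableEvenHeadParts: one kernel
declaration per claimed partial sum, final sign tests on the summed claims) restated on the EXISTENTIAL zeroth-order row
contract `EvenRows.ValidE` of `TaylorTableEvenRowsTable` (rows read off literal `(P, D)` tables — the kernel-cheap rows,
`validE_of_tables`), so that a point / very-narrow-box certificate can use cheap rows AND parts. Same conclusion (the
per-cell statement of `TaylorTable.EvenHeads`). Proof = `parts_pmem` on the chosen row lists + `evenHead_psd_of_pmem`.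
Wide boxes: `TaylorTableEvenHeadDelta` (δ-expanded row triples). No new mathematics.
Sources: Kos–Poland–Simmons-Duffin 2014 §3.3 eq. (3.16). [folklore]
-/

namespace Summit.CriticalPhenomena.Ising3D

open Finset Set
open Literature.Analysis.ValidatedNumerics Literature.Analysis.ValidatedNumerics.PolyMP
open Literature.Analysis.ValidatedNumerics.NumericsMP (MI)
open Literature.MathematicalPhysics.QuantumFieldTheory.ConformalBootstrap3D

/-! ### Part 1. Parts on the existential zeroth-order row contract `ValidE` -/

section PartsE

variable (c : Fin 5 → ℕ × ℕ → ℚ) {L : List (ℕ × ℕ)} {C : EvenCellTM} (hF : C.F.Nodup)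
  (hFj : ∀ q ∈ C.F, q.2 ≤ C.ℓ + q.1) (hℓlo : (C.ℓ : ℚ) ≤ C.lo) {σlo σhi εlo εhi : ℚ} {R : EvenRows}
  (hR : R.ValidE c L σlo σhi εlo εhi)
include hF hFj hℓlo hR

/-- **Even head cell, FAST form SPLIT INTO PARTS, on the existential row contract `ValidE`** (rows from literal
`(P, D)` tables): every part's containment check and the final check on the summed claims ⇒ the head form is PSD on
box × cell. [cite: KosPolandSimmonsduffin2014, §3.3 eq. (3.16)] -/
theorem evenHead_nonneg_of_parts_E {dP : ℕ} {ps : List HeadPart} (hparts : ∀ p ∈ ps, evenHeadPartOK R C p = true)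
    (h : evenHeadPartsFinalOK R dP C ps = true) :
    ∀ p ∈ Icc (σlo : ℝ) σhi ×ˢ Icc (εlo : ℝ) εhi, ∀ Δ : ℝ, (C.lo : ℝ) ≤ Δ → Δ ≤ C.hi → ∀ a b : ℝ,
      0 ≤ ∑ q ∈ C.F.toFinset, hrCoeff Δ C.ℓ q.1 q.2 / legendreLam C.ℓ *
        (taylorCrossing (1 / 2) (1 / 2) L.toFinset (fun i ab => (c i ab : ℝ))).evenForm p.1 p.2
          (zMono (Δ + (q.1 : ℝ)) q.2) a b := by
  intro p hp Δ hlo hhi a b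
  obtain ⟨hσ, hε⟩ := hp
  simp only [evenHeadPartsFinalOK, Bool.and_eq_true, decide_eq_true_eq, List.all_eq_true] at h
  obtain ⟨⟨⟨⟨⟨⟨⟨hS, hD⟩, hpiv⟩, hJ⟩, htile⟩, hX⟩, hY⟩, hDisc⟩ := h
  set ρ : ℝ := Δ - (C.ctr : ℝ) with hρdef
  have hΔ : Δ = (C.ctr : ℝ) + ρ := by rw [hρdef]; ring
  have hlo' : ((C.lo : ℚ) : ℝ) = (C.ctr : ℝ) - ((C.hw : ℚ) : ℝ) := by rw [EvenCellTM.lo]; push_cast; ring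
  have hhi' : ((C.hi : ℚ) : ℝ) = (C.ctr : ℝ) + ((C.hw : ℚ) : ℝ) := by rw [EvenCellTM.hi]; push_cast; ring
  have hρabs : |ρ| ≤ ((1 : ℚ) / 2 ^ C.e : ℚ) := by
    have : ((C.hw : ℚ) : ℝ) = (((1 : ℚ) / 2 ^ C.e : ℚ) : ℝ) := by rw [EvenCellTM.hw]
    rw [abs_le, ← this]; constructor <;> [ (push_cast; linarith) ; linarith ]
  -- Taylor models at this ρ
  have htm : ∀ q ∈ C.F, ∃ as : List ℝ, PMem R.S as (HRTM.rowEntry (HRTM.rows R.S C.ctr C.ℓ C.e C.D C.nF) C.nF q.1 q.2) ∧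
      hrCoeff ((C.ctr : ℝ) + ρ) C.ℓ q.1 q.2 = evalR as ρ :=
    fun q hq => HRTM.tmem_rows hD hpiv (C.le_nF q hq) q.2 ρ hρabs
  classical
  let asq : ℕ × ℕ → List ℝ := fun q => if hq : q ∈ C.F then Classical.choose (htm q hq) else []
  have hasq_mem : ∀ q ∈ C.F, PMem R.S (asq q) (HRTM.rowEntry (HRTM.rows R.S C.ctr C.ℓ C.e C.D C.nF) C.nF q.1 q.2) := by
    intro q hq; simp only [asq, dif_pos hq]; exact (Classical.choose_spec (htm q hq)).1
  have hasq_val : ∀ q ∈ C.F, hrCoeff ((C.ctr : ℝ) + ρ) C.ℓ q.1 q.2 = evalR (asq q) ρ := by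
    intro q hq; simp only [asq, dif_pos hq]; exact (Classical.choose_spec (htm q hq)).2
  -- rows from the existential contract (choose per j)
  have hV := fun j (hj : j < R.J) => hR.2 p.1 hσ p.2 hε j hj
  let rowX : ℕ → List ℝ := fun j => if hj : j < R.J then Classical.choose (hV j hj).1 else []
  let rowY : ℕ → List ℝ := fun j => if hj : j < R.J then Classical.choose (hV j hj).2.1 else []
  let rowZ : ℕ → List ℝ := fun j => if hj : j < R.J then Classical.choose (hV j hj).2.2 else []
  have hrowX : ∀ q ∈ C.F, PMem R.S (rowX q.2) (R.RX.getD q.2 []) := by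
    intro q hq; simp only [rowX, dif_pos (hJ q hq)]; exact (Classical.choose_spec (hV q.2 (hJ q hq)).1).1
  have hrowY : ∀ q ∈ C.F, PMem R.S (rowY q.2) (R.RY.getD q.2 []) := by
    intro q hq; simp only [rowY, dif_pos (hJ q hq)]; exact (Classical.choose_spec (hV q.2 (hJ q hq)).2.1).1
  have hrowZ : ∀ q ∈ C.F, PMem R.S (rowZ q.2) (R.RZ.getD q.2 []) := by
    intro q hq; simp only [rowZ, dif_pos (hJ q hq)]; exact (Classical.choose_spec (hV q.2 (hJ q hq)).2.2).1
  have erowX : ∀ q ∈ C.F, ∀ E : ℝ, qSum (fun ab => (c 0 ab : ℝ)) L.toFinset p.1 (-1) E q.2 = evalR (rowX q.2) E := by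
    intro q hq E; simp only [rowX, dif_pos (hJ q hq)]; exact (Classical.choose_spec (hV q.2 (hJ q hq)).1).2 E
  have erowY : ∀ q ∈ C.F, ∀ E : ℝ, qSum (fun ab => (c 1 ab : ℝ)) L.toFinset p.2 (-1) E q.2 = evalR (rowY q.2) E := by
    intro q hq E; simp only [rowY, dif_pos (hJ q hq)]; exact (Classical.choose_spec (hV q.2 (hJ q hq)).2.1).2 E
  have erowZ : ∀ q ∈ C.F, ∀ E : ℝ, qSum (fun ab => (c 3 ab : ℝ)) L.toFinset ((p.1 + p.2) / 2) (-1) E q.2 +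
      qSum (fun ab => (c 4 ab : ℝ)) L.toFinset ((p.1 + p.2) / 2) 1 E q.2 = evalR (rowZ q.2) E := by
    intro q hq E; simp only [rowZ, dif_pos (hJ q hq)]; exact (Classical.choose_spec (hV q.2 (hJ q hq)).2.2).2 E
  -- the parts
  have hparts' : ∀ p' ∈ ps, (subsetI (headPolyTM R.S R.RX (HRTM.rows R.S C.ctr C.ℓ C.e C.D C.nF) C.nF C.ℓ C.ctr (p'.slice C.F)) p'.PX &&
      subsetI (headPolyTM R.S R.RY (HRTM.rows R.S C.ctr C.ℓ C.e C.D C.nF) C.nF C.ℓ C.ctr (p'.slice C.F)) p'.PY &&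
      subsetI (headPolyTM R.S R.RZ (HRTM.rows R.S C.ctr C.ℓ C.e C.D C.nF) C.nF C.ℓ C.ctr (p'.slice C.F)) p'.PZ) = true :=
    fun p' hp' => by simpa [evenHeadPartOK] using hparts p' hp'
  obtain ⟨ax, ay, az, hPX, hPY, hPZ, eX', eY', eZ'⟩ :=
    parts_pmem hS (ℓ := C.ℓ) (ctr := C.ctr) hrowX hrowY hrowZ hasq_mem ρ ps 0 htile hparts'
  rw [List.drop_zero] at eX' eY' eZ'
  have eX := evenHeadX_eq_evalR_rows (σ := (-1 : ℝ)) C.ℓ C.ctr C.F ρ (by intro q hq E; simpa using erowX q hq E) hasq_val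
  have eY := evenHeadX_eq_evalR_rows (σ := (-1 : ℝ)) C.ℓ C.ctr C.F ρ (by intro q hq E; simpa using erowY q hq E) hasq_val
  have eZ : evenHeadX (fun ab => (c 3 ab : ℝ)) L.toFinset C.ℓ C.F ((p.1 + p.2) / 2) ((C.ctr : ℝ) + ρ) (-1) +
      evenHeadX (fun ab => (c 4 ab : ℝ)) L.toFinset C.ℓ C.F ((p.1 + p.2) / 2) ((C.ctr : ℝ) + ρ) 1 =
      evalR (headPolyTMR rowZ asq C.ℓ C.ctr C.F) ρ := by
    rw [evalR_headPolyTMR, evenHeadX, evenHeadX, ← List.sum_map_add]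
    congr 1
    refine List.map_congr_left fun q hq => ?_
    have ez := erowZ q hq ((C.ctr : ℝ) + ρ + (q.1 : ℝ))
    rw [← hasq_val q hq, show (q.1 : ℝ) + (C.ctr : ℝ) + ρ = (C.ctr : ℝ) + ρ + (q.1 : ℝ) by ring, ← ez]
    have hlam : ((PointKernel.legendreLamQ C.ℓ : ℚ) : ℝ) = legendreLam C.ℓ := PointKernel.cast_legendreLamQ C.ℓ
    push_cast
    rw [hlam]
    have hl0 : legendreLam C.ℓ ≠ 0 := (legendreLam_pos C.ℓ).ne'
    have h2 : (2 : ℝ) ^ q.1 ≠ 0 := pow_ne_zero _ two_ne_zero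
    rw [one_div_pow]
    field_simp
  rw [hΔ]
  refine evenHead_psd_of_pmem c L hF hFj hℓlo hS hX hY hDisc p (by rw [← hΔ]; exact hlo) (by rw [← hΔ]; exact hhi)
    hPX hPY hPZ ?_ ?_ ?_ a b
  · rw [show (C.ctr : ℝ) + ρ - C.ctr = ρ by ring, eX', ← eX]
  · rw [show (C.ctr : ℝ) + ρ - C.ctr = ρ by ring, eY', ← eY]
  · rw [show (C.ctr : ℝ) + ρ - C.ctr = ρ by ring, eZ', ← eZ]

end PartsE

end Summit.CriticalPhenomena.Ising3D
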